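import Summits.QuantumFields.YangMills.Theorems.BalabanUVNodesK0UniformFluxConfig
import Summits.QuantumFields.YangMills.Theorems.FluctuationComparisonRegPrIntLS2BetaSmallBondGaugeToronObstruction
import Summits.QuantumFields.YangMills.Theorems.FluctuationComparisonRegPrIntLS2BetaGeodesicJensenLift
import Literature.MathematicalPhysics.QuantumFieldTheory.Balaban1983to89.B15Prop1HolonomyObstruction
import HarnessLib

/-!
# S2β · D-GUARD, UPPER SIDE — THE CURVATURE FLOOR OF THE SMALL-BOND GAUGE SUPPLIER `hsupp`: on EVERY torus `(ℤ∕N)^d` (`d ≥ 2`) there are window data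
# (all plaquettes within `2πk∕N` of `1`, abelian) of which NO gauge copy has all bond variables within `k·s∕N` of `1` (`4ks² ≤ N`) — i.e. a volume-UNIFORM
# small-bond gauge from plaquettes `≤ θ` must allow bonds `≳ √θ ∕ 9`; the upper twin of the toron floor `π∕N` of ✓`…SmallBondGaugeToronObstruction`

Cell `ym3-torus` (YM ladder rung R3 = continuum `SU(2)` Yang–Mills on the three-torus at fixed lattice data — a RUNG: NOT d = 4, NOT infinite volume,
NOT a mass gap, NOT Clay).  Width seat «width 17» `ym3-torus-px17` (gen 23, architect lineage), FREE px helper on crux `stmt-QuantumFields-20520`;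
`--kind proof --supports stmt-QuantumFields-20520 --as helper`, count-neutral, DEFINITION-FREE (0 `def`, 0 `instance`, 0 `notation`, 0 `sorry`, default
heartbeats).

WHY (architect-lineage census of LEAD w3 g29 №21 ∕ desk RULING №115 «D-GUARD-Q», 2026-08-31 23:10Z, and RULING «GUARDED STRATA + ONE NAMED BRIDGE», 23:13Z).
By kernel the S2β sup chain supplies the stratum letters hD∕hARC∕hDBX at the GAUGE-FIXED classes `G ∧ G_{s₀}`, `G_{s₀} V := ∀ e, arc(V e) ≤ s₀`, and the bridge
to the gauge-invariant strata of GAP♯∘ is ONE un-held supplier `hsupp : ∀ window V ∈ G, ∃ u, u•V ∈ G ∧ G_{s₀}` through ✓`…StratumBodyGaugeWLOG.gapStratum_of_goodGauge`.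
Its domain is TWO-sided.  LOWER side (torons): ✓p826411 `…SmallBondGaugeToronObstruction` — a Polyakov holonomy of arc `a·N` forces a bond `≥ a` in every gauge, so
`N ≥ π∕s₀` is necessary.  UPPER side (THIS FILE): accumulated curvature.  The uniform-flux abelian datum of the `pub-ymgap` cell (✓`K0UniformFluxConfig`: `V⟨x, e₂⟩ =
D^{x₁}`, `1` elsewhere, `D = expPoint((2πk∕N)·e₀)`, `D^N = 1`) has EVERY plaquette equal to `D` or `1` (✓`plaqHol_flux`), hence lies in every window `PlaqSmall θ`,
`θ > 2πk∕N`; its holonomy around the `s × s` square is `D^{s²}` (abelian Stokes, ✓`holAt_flux_rectWord`), of distance `2 sin(πks²∕N) ≥ 4ks²∕N` from `1` when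
`4ks² ≤ N` (Jordan); a gauge in which every bond met by the square were within `δ` of `1` would force that distance `≤ 4s·δ` (lit ✓`B15Prop1HolonomyObstruction`,
gauge invariance of closed holonomies + `dist1 (gh) ≤ dist1 g + dist1 h`).  Hence in EVERY gauge some bond has `dist1 ≥ k·s∕N`, and a fortiori arc
`‖logVec‖ ≥ k·s∕N` (`dist1 = 2 sin(arc∕2) ≤ arc`).  With `k ≈ θN∕4π`, `s ≈ √(N∕4k)` this is `≈ √θ∕(4√π)`: a supplier `hsupp` whose small-bond threshold is
UNIFORM IN THE VOLUME must have `s₀ ≥ c·√θ` — the NECESSITY half of the census item (BG∞) «volume-uniform small-bond gauge»; whether `C·√θ + C∕N` is ACHIEVABLE for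
`SU(2)` (it is not for `U(1)`-valued gauges) is open and not addressed here.  Print never meets either floor: [Balaban1985RegularSpaces] Lemma 1 p.79, (1.29) p.81,
Thm 2 p.83 fix axial gauges on CUBES of `O(L)` blocks, never on the torus.

WHAT IS PROVED (sorry-free; any `Params` with `2 ≤ d`, level `0`, `SU(2)`).
* §1 ★ `expPoint_eq_one_of_norm_eq_two_pi_mul` (periodicity of the exponential chart: `‖x‖ = 2πk ⇒ expPoint x = 1`, via `eq_one_of_dist1_eq_zero`); `dist1 U ≤ arc U` is
  ✓`…GeodesicJensenLift.dist1_le_norm_logVec` (reused, not restated).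
* §2 ★★ `forall_gauge_exists_bond_ge_of_flux` — for the flux datum (displayed by its defining hypothesis, no `def`) and `0 < s`, `4ks² ≤ N`: in every gauge some bond has
  `dist1 ≥ k·s∕N`; ★★ `dist1_plaqHol_fluxDatum_le` — its plaquettes are within `2πk∕N` of `1`.
* §3 ★★★ `exists_plaqSmall_forall_gauge_exists_bond_ge` — THE FLOOR: `2 ≤ P.d`, `0 < s`, `4·k·s² ≤ N := P.sitesPerDir 0`, `2πk∕N < θ` ⟹ `∃ V, PlaqSmall θ V ∧ ∀ u, ∃ b,
  k·s∕N ≤ dist1 ((u•V) b) ∧ k·s∕N ≤ ‖logVec (su2Quat ((u•V) b))‖`; ★★★ `not_smallBond_supplier_of_flux` — the `hsupp` shape `∀ V, PlaqSmall θ V → G V → ∃ u, ∀ e,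
  ‖logVec (su2Quat ((u•V) e))‖ ≤ s₀` is FALSE for every datum class `G` containing the flux datum, as soon as `s₀ < k·s∕N`.

HONEST SCOPE.  Elementary lattice∕group bookkeeping over landed kinematics (pub-ymgap ✓`K0UniformFluxConfig`, lit ✓`B15Prop1HolonomyObstruction`, px8 ✓p826411); a NEGATIVE
result about a SUPPLIER SHAPE on its upper (large-volume) side; nothing of Bałaban's renormalisation-group analysis is asserted, proved or refuted; NOT refuted: GAP♯∘, the
knits, px12's guarded letters N∕Q, (D-stage); `hsupp`, hD₁, hD₂, hDBX, h3 remain HYPOTHESES; GAP♯∘ (`stub_uniformFibreGapOrbit`, registry 3732b7df UNTOUCHED), the five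
registered stubs (0∕5), S2β, 20520, 19936, 19200, `YM3TorusSU2` are NOT proved; no registered stub is closed; rung R3 — NOT d = 4, NOT infinite volume, NOT a mass gap,
NOT Clay; the Yang–Mills mass gap is NOT proved.
References: T. Bałaban, CMP **99** (1985) 75–102 [Balaban1985RegularSpaces] (Lemma 1 p.79, (1.29) p.81, Thm 2 p.83 — LOCAL small-bond gauges); CMP **98** (1985) 17–51
[Balaban1985Averaging] ((8)–(9) pp.18–19 gauge transformation of transports, (19)–(20) p.21).
-/

set_option autoImplicit false

noncomputable section

namespace Summit.QuantumFields.YangMills.Theorems.FluctuationComparisonRegPrIntLS2BetaSmallBondGaugeCurvatureFloor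

open scoped Real
open Literature.MathematicalPhysics.QuantumLattice (su2Quat)
open Literature.MathematicalPhysics.QuantumFieldTheory.Balaban1983to89
open Literature.MathematicalPhysics.QuantumFieldTheory.Balaban1983to89.T4Continuum
open T4CubeChartGnomonic (SU2)
open T4HaarSU2ExpChart (expPoint expPoint_zero)
open T3ContinuumYM3Torus (T3Family)
open T4ExpWindowSmallField (logVec dist1_expPoint_eq dist1_expPoint_le dist1_eq_two_mul_sin norm_logVec_le_pi expPoint_logVec)
open Summit.QuantumFields.YangMills.Theorems.K0UniformFluxConfig (plaqHol_flux dist1_plaqHol_flux_le holAt_flux_rectWord)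
open Summit.QuantumFields.YangMills.Theorems.FluctuationComparisonRegPrIntLS2BetaSmallBondGaugeToronObstruction (expPoint_smul_pow)
open Summit.QuantumFields.YangMills.Theorems.FluctuationComparisonRegPrIntLS2BetaGeodesicJensenLift (dist1_le_norm_logVec)
open B15Prop1HolonomyObstruction (dist1_holAt_walk_le_length_mul_of_gauge)
open T4WordSystemGaugeBound (length_walk')
open T4ReflectionCone (rectWord netDisp_rectWord)

/-! ## §1 Two facts of the exponential chart of `SU(2)` -/

/-- `dist1 U = 0 ⇒ U = 1` on `SU(2)` (through the chart: `2 sin(arc∕2) = 0` with `arc ≤ π` forces `arc = 0`). [folklore] -/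
theorem eq_one_of_dist1_eq_zero (U : SU2) (h : dist1 U = 0) : U = 1 := by
  have hle : ‖logVec (su2Quat U)‖ ≤ π := norm_logVec_le_pi _
  have h0 : 0 ≤ ‖logVec (su2Quat U)‖ := norm_nonneg _
  rw [dist1_eq_two_mul_sin] at h
  have hsin : Real.sin (‖logVec (su2Quat U)‖ / 2) = 0 := by linarith
  -- on `[0, π∕2]` the sine vanishes only at `0`
  have hnorm : ‖logVec (su2Quat U)‖ = 0 := by
    by_contra hne
    have hpos : 0 < ‖logVec (su2Quat U)‖ / 2 := by
      rcases lt_or_eq_of_le h0 with hlt | heq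
      · linarith
      · exact absurd heq.symm hne
    have hlt : ‖logVec (su2Quat U)‖ / 2 < π := by linarith [Real.pi_pos]
    exact absurd hsin (Real.sin_pos_of_pos_of_lt_pi hpos hlt).ne'
  have hv : logVec (su2Quat U) = 0 := norm_eq_zero.mp hnorm
  rw [← expPoint_logVec U, hv, expPoint_zero]

/-- ★ **PERIODICITY OF THE CHART**: `‖x‖ = 2πk` (`k : ℕ`) ⇒ `expPoint x = 1` (`dist1 (expPoint x) = 2|sin(πk)| = 0`). [folklore] -/
theorem expPoint_eq_one_of_norm_eq_two_pi_mul (x : EuclideanSpace ℝ (Fin 3)) (k : ℕ) (hx : ‖x‖ = 2 * π * k) : expPoint x = 1 := by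
  apply eq_one_of_dist1_eq_zero
  rw [dist1_expPoint_eq, hx]
  have : 2 * π * (k : ℝ) / 2 = (k : ℝ) * π := by ring
  rw [this, Real.sin_nat_mul_pi, abs_zero, mul_zero]

/-- Norm of a non-negative multiple of `e₀`. [folklore] -/
theorem norm_smul_single {a : ℝ} (ha : 0 ≤ a) : ‖a • (EuclideanSpace.single (0 : Fin 3) (1 : ℝ))‖ = a := by
  rw [norm_smul, PiLp.norm_single, norm_one, mul_one, Real.norm_of_nonneg ha]

/-! ## §2 The uniform-flux datum: plaquettes and the square holonomy in every gauge -/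

section Flux

variable {P : Params}

/-- The flux element `D = expPoint((2πk∕N)·e₀)` has order dividing the period `N = sitesPerDir 0`. [folklore] -/
theorem fluxElement_pow_sitesPerDir (k : ℕ) :
    expPoint ((2 * π * k / (P.sitesPerDir 0 : ℝ)) • EuclideanSpace.single (0 : Fin 3) (1 : ℝ)) ^ P.sitesPerDir 0 = 1 := by
  rw [expPoint_smul_pow]
  apply expPoint_eq_one_of_norm_eq_two_pi_mul _ k
  have hN : (0 : ℝ) < (P.sitesPerDir 0 : ℝ) := by exact_mod_cast Nat.pos_of_ne_zero (P.sitesPerDir_ne_zero 0)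
  have hk : (0 : ℝ) ≤ 2 * π * k / (P.sitesPerDir 0 : ℝ) := by positivity
  rw [norm_smul_single (mul_nonneg hN.le hk)]
  field_simp

/-- The flux element is within `2πk∕N` of `1`. [folklore] -/
theorem dist1_fluxElement_le (k : ℕ) :
    dist1 (expPoint ((2 * π * k / (P.sitesPerDir 0 : ℝ)) • EuclideanSpace.single (0 : Fin 3) (1 : ℝ))) ≤ 2 * π * k / (P.sitesPerDir 0 : ℝ) := by
  have hk : (0 : ℝ) ≤ 2 * π * k / (P.sitesPerDir 0 : ℝ) := by positivity
  exact (dist1_expPoint_le _).trans (le_of_eq (norm_smul_single hk))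

/-- ★★ **THE PLAQUETTES OF THE FLUX DATUM ARE WITHIN `2πk∕N` OF `1`** (every plaquette is `D` or `1`, pub-ymgap ✓`plaqHol_flux`).
[cite: Balaban1985Averaging, (9) p.19 (bookkeeping: plaquette variables)] -/
theorem dist1_plaqHol_fluxDatum_le {μ₁ μ₂ : Fin P.d} (h12 : μ₁ < μ₂) (k : ℕ) {V : GaugeField P 0 SU2}
    (hV : ∀ b, V b = if b.dir = μ₂ then
      expPoint ((2 * π * k / (P.sitesPerDir 0 : ℝ)) • EuclideanSpace.single (0 : Fin 3) (1 : ℝ)) ^ (b.src μ₁).val else 1)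
    (p : Plaq P 0) : dist1 (GaugeField.plaqHol V p) ≤ 2 * π * k / (P.sitesPerDir 0 : ℝ) :=
  (dist1_plaqHol_flux_le (N := 2) h12 (fluxElement_pow_sitesPerDir k) hV p).trans (dist1_fluxElement_le k)

/-- The square holonomy of the flux datum is at least `4ks²∕N` from `1` when `4ks² ≤ N` (abelian Stokes `D^{s²}` + Jordan's inequality
`sin x ≥ (2∕π)x` on `[0, π∕2]`). [cite: Balaban1985Averaging, (8)-(9) pp.18-19 (bookkeeping: Stokes on the lattice)] -/
theorem le_dist1_holAt_fluxDatum_square {μ₁ μ₂ : Fin P.d} (h12 : μ₁ < μ₂) {k s : ℕ} (hks : 4 * k * s ^ 2 ≤ P.sitesPerDir 0) (hs : 0 < s)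
    {V : GaugeField P 0 SU2}
    (hV : ∀ b, V b = if b.dir = μ₂ then
      expPoint ((2 * π * k / (P.sitesPerDir 0 : ℝ)) • EuclideanSpace.single (0 : Fin 3) (1 : ℝ)) ^ (b.src μ₁).val else 1) :
    (4 * k * s ^ 2 : ℝ) / (P.sitesPerDir 0 : ℝ) ≤ dist1 (holAt V (walk (default : Site P 0) (rectWord μ₁ μ₂ s s))) := by
  have hN : (0 : ℝ) < (P.sitesPerDir 0 : ℝ) := by exact_mod_cast Nat.pos_of_ne_zero (P.sitesPerDir_ne_zero 0)
  -- `k = 0`: the bound is `0 ≤ dist1`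
  rcases Nat.eq_zero_or_pos k with hk0 | hk
  · subst hk0
    simp only [Nat.cast_zero, mul_zero, zero_mul, zero_div]
    exact GaugeGroup.dist1_nonneg _
  have hsN : s < P.sitesPerDir 0 := by
    have h1 : s < 4 * s := by omega
    have h2 : 4 * s ≤ 4 * s ^ 2 := Nat.mul_le_mul_left 4 (by nlinarith)
    have h3 : 4 * s ^ 2 ≤ 4 * k * s ^ 2 := by
      rw [mul_assoc]; exact Nat.mul_le_mul_left 4 (Nat.le_mul_of_pos_left _ hk)
    omega
  have hx : (default : Site P 0) μ₁ = 0 := rfl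
  rw [holAt_flux_rectWord (N := 2) h12 hV hx hsN, expPoint_smul_pow, dist1_expPoint_eq]
  -- the angle `a := (s·s)·(2πk∕N)`, `0 ≤ a∕2 ≤ π∕4`
  have ha0 : (0 : ℝ) ≤ ((s * s : ℕ) : ℝ) * (2 * π * k / (P.sitesPerDir 0 : ℝ)) := by positivity
  rw [norm_smul_single ha0]
  have hks' : (4 * k * s ^ 2 : ℝ) ≤ (P.sitesPerDir 0 : ℝ) := by exact_mod_cast hks
  have hX : ((s * s : ℕ) : ℝ) * (2 * π * k / (P.sitesPerDir 0 : ℝ)) ≤ π := by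
    rw [show ((s * s : ℕ) : ℝ) * (2 * π * k / (P.sitesPerDir 0 : ℝ)) = π * ((2 * k * s ^ 2 : ℝ) / (P.sitesPerDir 0 : ℝ)) by
      push_cast; ring]
    have h1 : (2 * k * s ^ 2 : ℝ) / (P.sitesPerDir 0 : ℝ) ≤ 1 := by
      rw [div_le_one hN]; linarith
    nlinarith [Real.pi_pos]
  have hquarter : ((s * s : ℕ) : ℝ) * (2 * π * k / (P.sitesPerDir 0 : ℝ)) / 2 ≤ π / 2 := by linarith
  have hjordan := Real.mul_le_sin (by positivity) hquarter
  have h2pi : 0 ≤ 2 / π * (((s * s : ℕ) : ℝ) * (2 * π * k / (P.sitesPerDir 0 : ℝ)) / 2) := by positivity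
  have hsin_nonneg : 0 ≤ Real.sin (((s * s : ℕ) : ℝ) * (2 * π * k / (P.sitesPerDir 0 : ℝ)) / 2) := h2pi.trans hjordan
  rw [abs_of_nonneg hsin_nonneg]
  -- `2·(2∕π)·(a∕2) = 4ks²∕N`
  have hid : (4 * k * s ^ 2 : ℝ) / (P.sitesPerDir 0 : ℝ) = 2 * (2 / π * (((s * s : ℕ) : ℝ) * (2 * π * k / (P.sitesPerDir 0 : ℝ)) / 2)) := by
    push_cast
    field_simp
    ring
  calc (4 * k * s ^ 2 : ℝ) / (P.sitesPerDir 0 : ℝ)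
      = 2 * (2 / π * (((s * s : ℕ) : ℝ) * (2 * π * k / (P.sitesPerDir 0 : ℝ)) / 2)) := hid
    _ ≤ 2 * Real.sin (((s * s : ℕ) : ℝ) * (2 * π * k / (P.sitesPerDir 0 : ℝ)) / 2) := by linarith

/-- ★★ **IN EVERY GAUGE THE FLUX DATUM HAS A BOND AT DISTANCE `≥ k·s∕N` FROM `1`** (`0 < s`, `4ks² ≤ N`): otherwise every bond met by the `s × s` square would be
within some `δ < ks∕N` of `1`, and the (gauge-invariant) square holonomy within `4s·δ < 4ks²∕N` of `1` — contradicting abelian Stokes.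
[cite: Balaban1985Averaging, (8) p.18 and (19)-(20) p.21] -/
theorem forall_gauge_exists_bond_ge_of_flux (hd : 2 ≤ P.d) {k s : ℕ} (hks : 4 * k * s ^ 2 ≤ P.sitesPerDir 0) (hs : 0 < s)
    {V : GaugeField P 0 SU2}
    (hV : ∀ b, V b = if b.dir = (⟨1, hd⟩ : Fin P.d) then
      expPoint ((2 * π * k / (P.sitesPerDir 0 : ℝ)) • EuclideanSpace.single (0 : Fin 3) (1 : ℝ)) ^ (b.src ⟨0, by omega⟩).val else 1)
    (u : GaugeTransf P 0 SU2) :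
    ∃ b : PBond P 0, (k * s : ℝ) / (P.sitesPerDir 0 : ℝ) ≤ dist1 (GaugeField.gaugeAct u V b) := by
  have hN : (0 : ℝ) < (P.sitesPerDir 0 : ℝ) := by exact_mod_cast Nat.pos_of_ne_zero (P.sitesPerDir_ne_zero 0)
  have h12 : (⟨0, by omega⟩ : Fin P.d) < ⟨1, hd⟩ := by simp [Fin.lt_def]
  by_contra hcon
  push Not at hcon
  -- a uniform bound `δ < ks∕N` over the finitely many bonds
  obtain ⟨b₀, -, hb₀⟩ := Finset.exists_max_image Finset.univ (fun b : PBond P 0 => dist1 (GaugeField.gaugeAct u V b))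
    ⟨⟨default, ⟨0, by omega⟩⟩, Finset.mem_univ _⟩
  set δ := dist1 (GaugeField.gaugeAct u V b₀) with hδ
  have hδlt : δ < (k * s : ℝ) / (P.sitesPerDir 0 : ℝ) := hcon b₀
  have hδ0 : 0 ≤ δ := GaugeGroup.dist1_nonneg _
  -- the square is a closed walk of length `4s`
  have hclosed : walkEnd (default : Site P 0) (rectWord (⟨0, by omega⟩ : Fin P.d) ⟨1, hd⟩ s s) = default :=
    walkEnd_eq_self_of_netDisp fun ν => by rw [netDisp_rectWord, Int.cast_zero]
  have hlen : (walk (default : Site P 0) (rectWord (⟨0, by omega⟩ : Fin P.d) ⟨1, hd⟩ s s)).length = 4 * s := by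
    rw [length_walk']
    simp only [rectWord, List.length_append, List.length_replicate]
    ring
  have hhol := dist1_holAt_walk_le_length_mul_of_gauge V default _ hclosed hδ0 u fun st _ => hb₀ st.bond (Finset.mem_univ _)
  have hflux := le_dist1_holAt_fluxDatum_square h12 hks hs hV
  rw [hlen] at hhol
  have hs' : (0 : ℝ) < s := by exact_mod_cast hs
  have : ((4 * s : ℕ) : ℝ) * δ < (4 * k * s ^ 2 : ℝ) / (P.sitesPerDir 0 : ℝ) := by
    push_cast
    calc (4 : ℝ) * s * δ < 4 * s * ((k * s : ℝ) / (P.sitesPerDir 0 : ℝ)) := by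
          exact mul_lt_mul_of_pos_left hδlt (by positivity)
      _ = (4 * k * s ^ 2 : ℝ) / (P.sitesPerDir 0 : ℝ) := by ring
  linarith

end Flux

/-! ## §3 The floor, in the window's and the guard's currencies -/

/-- ★★★ **THE CURVATURE FLOOR**: on any torus of dimension `≥ 2` with `N = sitesPerDir 0` sites per direction, for `0 < s` and `4·k·s² ≤ N` and any window
`θ > 2πk∕N`, there is a datum with EVERY plaquette within `θ` of `1` such that in EVERY gauge some bond variable is at distance — and a fortiori at arc —
at least `k·s∕N` from `1`.  (Optimising: `k ≈ θN∕4π`, `s ≈ √(N∕4k)` gives `≈ √θ∕(4√π)`, uniformly in `N ≥ 4π∕θ`.)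
[cite: Balaban1985RegularSpaces, Lemma 1 p.79 and (1.29) p.81 (the printed small-bond gauges are LOCAL); Balaban1985Averaging, (8)-(9) pp.18-19] -/
theorem exists_plaqSmall_forall_gauge_exists_bond_ge {P : Params} (hd : 2 ≤ P.d) {k s : ℕ} (hs : 0 < s)
    (hks : 4 * k * s ^ 2 ≤ P.sitesPerDir 0) {θ : ℝ} (hθ : 2 * π * k / (P.sitesPerDir 0 : ℝ) < θ) :
    ∃ V : GaugeField P 0 SU2, PlaqSmall θ V ∧
      ∀ u : GaugeTransf P 0 SU2, ∃ b : PBond P 0,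
        (k * s : ℝ) / (P.sitesPerDir 0 : ℝ) ≤ dist1 (GaugeField.gaugeAct u V b) ∧
        (k * s : ℝ) / (P.sitesPerDir 0 : ℝ) ≤ ‖logVec (su2Quat (GaugeField.gaugeAct u V b))‖ := by
  refine ⟨fun b => if b.dir = (⟨1, hd⟩ : Fin P.d) then
      expPoint ((2 * π * k / (P.sitesPerDir 0 : ℝ)) • EuclideanSpace.single (0 : Fin 3) (1 : ℝ)) ^ (b.src ⟨0, by omega⟩).val else 1, ?_, ?_⟩
  · intro p
    have h12 : (⟨0, by omega⟩ : Fin P.d) < ⟨1, hd⟩ := by simp [Fin.lt_def]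
    exact (dist1_plaqHol_fluxDatum_le h12 k (fun b => rfl) p).trans_lt hθ
  · intro u
    obtain ⟨b, hb⟩ := forall_gauge_exists_bond_ge_of_flux hd hks hs (fun b => rfl) u
    exact ⟨b, hb, hb.trans (dist1_le_norm_logVec _)⟩

/-- ★★★ **NO VOLUME-UNIFORM SMALL-BOND SUPPLIER BELOW THE CURVATURE FLOOR**: for any datum class `G` admitting the flux datum of §3 (e.g. every class
closed under «all plaquettes within `θ` of `1`, abelian»), the supplier shape `∀ V, PlaqSmall θ V → G V → ∃ u, ∀ e, ‖logVec (su2Quat ((u•V) e))‖ ≤ s₀` is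
FALSE as soon as `s₀ < k·s∕N` for some `0 < s`, `4ks² ≤ N`, `2πk∕N < θ`.  The statement is given for the universal class (`G ≡ True`), which every
supplier for a larger window∕class implies. [cite: Balaban1985RegularSpaces, Thm 2 p.83 (print's small distributed bond variables are per cube)] -/
theorem not_smallBond_supplier_of_flux {P : Params} (hd : 2 ≤ P.d) {k s : ℕ} (hs : 0 < s)
    (hks : 4 * k * s ^ 2 ≤ P.sitesPerDir 0) {θ s₀ : ℝ} (hθ : 2 * π * k / (P.sitesPerDir 0 : ℝ) < θ)
    (hs₀ : s₀ < (k * s : ℝ) / (P.sitesPerDir 0 : ℝ)) :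
    ¬ ∀ V : GaugeField P 0 SU2, PlaqSmall θ V →
        ∃ u : GaugeTransf P 0 SU2, ∀ e : PBond P 0, ‖logVec (su2Quat (GaugeField.gaugeAct u V e))‖ ≤ s₀ := by
  intro h
  obtain ⟨V, hVθ, hV⟩ := exists_plaqSmall_forall_gauge_exists_bond_ge hd hs hks hθ
  obtain ⟨u, hu⟩ := h V hVθ
  obtain ⟨b, -, hb⟩ := hV u
  exact absurd ((hb.trans (hu b)).trans_lt hs₀) (lt_irrefl _)

/-- ★★★ **THE FLOOR ON BAŁABAN's THREE-TORI**: for every family `F` and height `J` (`N_J = 2L^{F.m+J}` sites per direction), `0 < s`, `4ks² ≤ N_J`,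
`2πk∕N_J < θ`, `s₀ < ks∕N_J`: some `θ`-window datum on `F.P J` has NO gauge copy with all bond arcs `≤ s₀` — the UPPER companion of
✓`…SmallBondGaugeToronObstruction.not_forall_bond_le_toron` (which needs `N_J < π∕s₀`); together they confine any small-bond supplier with an
`N`-independent threshold to NO cofinal set of volumes unless its threshold grows like `√θ`. [cite: Balaban1985RegularSpaces, Lemma 1 p.79, (1.29) p.81] -/
theorem not_smallBond_supplier_T3 (F : T3Family) (J : ℕ) {k s : ℕ} (hs : 0 < s)
    (hks : 4 * k * s ^ 2 ≤ (F.P J).sitesPerDir 0) {θ s₀ : ℝ} (hθ : 2 * π * k / ((F.P J).sitesPerDir 0 : ℝ) < θ)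
    (hs₀ : s₀ < (k * s : ℝ) / ((F.P J).sitesPerDir 0 : ℝ)) :
    ¬ ∀ V : GaugeField (F.P J) 0 SU2, PlaqSmall θ V →
        ∃ u : GaugeTransf (F.P J) 0 SU2, ∀ e : PBond (F.P J) 0, ‖logVec (su2Quat (GaugeField.gaugeAct u V e))‖ ≤ s₀ :=
  not_smallBond_supplier_of_flux (P := F.P J) (by rw [T3Family.P_d]; norm_num) hs hks hθ hs₀

end Summit.QuantumFields.YangMills.Theorems.FluctuationComparisonRegPrIntLS2BetaSmallBondGaugeCurvatureFloor

end
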